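import Summits.Ventures.QEC.CircuitDistance.PortNormal
import Summits.Ventures.QEC.CircuitDistance.SchedColumns
import HarnessLib

/-!
# Q4 lane, ₛ-spine (4): same columns, NORMAL fault sets and the `InitZ ↦ MeasZ` columns, for any CNOT order
# (venture QEC, experiment cell CDX; drafted by qec-cdx-idea-2 g2, typed by qec-cdx-type-2, statement audit qec-cdx-crit-1, director-qec R158; the `SameCols`/`logicalError_iff` items of `PortBridge.lean` and the
# `PortNormal.lean` layer of record re-pointed to `allEventsₛ σ Nc` under `hσ : σ.CycleFacts S`; nothing here asserts a value of `d_circ`)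

* `Gen.SameCols S Nc es F F'` (+ `refl`, `trans`), `Gen.logicalError_iff` — at `Gen` level over an arbitrary event list;
* `ancZxₛ_of_not_initZ`, `detZₛ_indep` / `detXₛ_indep`, `detZₛ_local` / `detXₛ_local`, `sameColsₛ_indep`, `transfer_normalₛ` (a normal
  undetectable logical set of the `Nc`-circuit of `σ` is one of every longer circuit of `σ`) — `Normal`, `Fault.isInitZ` are the tree's;
* `shapeₛ_eq_evolve_delta` and, FOR EVERY ORDER `σ` (from `cycleEventsₛ_eq_append` and the shape of `SMSchedule.roundEvents`
  only — its events are `InitX` / `CNOT` / `MeasZ` / idles, a `MeasZ` in round 7 only), the closed one-cycle shapes **`shapeₛ_initZ`**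
  (an `X` on its ancilla, no flips) and **`shapeₛ_measZ`** (no frame, one flip) — the statements of the landed `shape_initZ` / `shape_measZ`
  with `shape ↦ shapeₛ σ S`, no hypothesis;
* the shape data and columns `mZ/mX/dataXb/dataZb_initZₛ|measZₛ`, `ancZxₛ_initZ`, `detZₛ_initZ` … `detXₛ_measZ`, and
  `initZ_measZ_sameColsₛ (hσ)` (`InitZ@c ≡ MeasZ@(c+1)`), `initZ_last_sameColsₛ (hσ)` (`InitZ@Nc ≡ ∅`) — proofs verbatim from `PortNormal.lean`.
Generic in `σ` and `S` given `hσ` only.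
-/

namespace Summit.Ventures.QEC.CircuitDistance

open Literature.InformationTheory.QuantumCodes

variable {ℓ m : ℕ} [NeZero ℓ] [NeZero m]

/-! ## Same columns and the logical-error predicate, for an arbitrary event list -/

/-- Two fault sets have the SAME COLUMNS in the `Nc`-circuit with event list `es` (cf. `SameCols`). -/
def Gen.SameCols (S : SMCode ℓ m) (Nc : ℕ) (es : List Ev) (F F' : Finset (Fault ℓ m)) : Prop :=
  (∀ t i, Gen.detX S Nc es F' t i = Gen.detX S Nc es F t i) ∧ (∀ t j, Gen.detZ S Nc es F' t j = Gen.detZ S Nc es F t j) ∧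
    Gen.dataX S es F' = Gen.dataX S es F ∧ Gen.dataZ S es F' = Gen.dataZ S es F

/-- `Gen.SameCols` is reflexive. -/
theorem Gen.SameCols.refl (S : SMCode ℓ m) (Nc : ℕ) (es : List Ev) (F : Finset (Fault ℓ m)) : Gen.SameCols S Nc es F F :=
  ⟨fun _ _ => rfl, fun _ _ => rfl, rfl, rfl⟩

/-- `Gen.SameCols` is transitive. -/
theorem Gen.SameCols.trans {S : SMCode ℓ m} {Nc : ℕ} {es : List Ev} {F F' F'' : Finset (Fault ℓ m)}
    (h : Gen.SameCols S Nc es F F') (h' : Gen.SameCols S Nc es F' F'') : Gen.SameCols S Nc es F F'' :=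
  ⟨fun t i => (h'.1 t i).trans (h.1 t i), fun t j => (h'.2.1 t j).trans (h.2.1 t j), h'.2.2.1.trans h.2.2.1,
    h'.2.2.2.trans h.2.2.2⟩

/-- `Gen.LogicalError` unfolded per sector (cf. `logicalError_iff`). -/
theorem Gen.logicalError_iff (S : SMCode ℓ m) (es : List Ev) (F : Finset (Fault ℓ m)) :
    Gen.LogicalError S es F ↔ Gen.dataX S es F ∉ rowSpace S.toCode.HX ∨ Gen.dataZ S es F ∉ rowSpace S.toCode.HZ := by
  unfold Gen.LogicalError; rw [not_and_or]; exact Iff.rfl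

/-! ## Normal fault sets: `Nc`-independence and locality of their columns -/

/-- A non-`InitZ` fault leaves no `ζ`. -/
theorem ancZxₛ_of_not_initZ (σ : SMSchedule) (S : SMCode ℓ m) (f : Fault ℓ m) (hf : f.isInitZ = false) (j : BB.Mono ℓ m) :
    (shapeₛ σ S f).frame.ancZx j = false := by
  rw [shapeₛ_ancZx]
  cases f <;> simp_all [Fault.isInitZ]

/-- Columns of normal faults do not depend on `Nc` (`Z`-detectors). -/
theorem detZₛ_indep {σ : SMSchedule} {S : SMCode ℓ m} (hσ : σ.CycleFacts S) {Nc Nc' : ℕ} (f : Fault ℓ m) (hf : f.isInitZ = false) (h₁ : 1 ≤ f.cyc)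
    (h₂ : f.cyc ≤ Nc) (h₂' : f.cyc ≤ Nc') (t : ℕ) (j : BB.Mono ℓ m) : Gen.detZ S Nc (allEventsₛ σ Nc) {f} t j = Gen.detZ S Nc' (allEventsₛ σ Nc') {f} t j := by
  rw [detZₛ_singleton hσ Nc f h₁ h₂, detZₛ_singleton hσ Nc' f h₁ h₂', ancZxₛ_of_not_initZ σ S f hf]
  simp

/-- Columns of normal faults do not depend on `Nc` (`X`-detectors). -/
theorem detXₛ_indep {σ : SMSchedule} {S : SMCode ℓ m} (hσ : σ.CycleFacts S) {Nc Nc' : ℕ} (f : Fault ℓ m) (h₁ : 1 ≤ f.cyc) (h₂ : f.cyc ≤ Nc) (h₂' : f.cyc ≤ Nc')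
    (t : ℕ) (i : BB.Mono ℓ m) : Gen.detX S Nc (allEventsₛ σ Nc) {f} t i = Gen.detX S Nc' (allEventsₛ σ Nc') {f} t i := by
  rw [detXₛ_singleton hσ Nc f h₁ h₂, detXₛ_singleton hσ Nc' f h₁ h₂']

/-- δ = 1 LOCALITY (`Z`-detectors): a normal fault of cycle `c` fires only layers `c`, `c+1`. -/
theorem detZₛ_local {σ : SMSchedule} {S : SMCode ℓ m} (hσ : σ.CycleFacts S) (Nc : ℕ) (f : Fault ℓ m) (hf : f.isInitZ = false) (h₁ : 1 ≤ f.cyc) (h₂ : f.cyc ≤ Nc)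
    {t : ℕ} (ht : t ≠ f.cyc ∧ t ≠ f.cyc + 1) (j : BB.Mono ℓ m) : Gen.detZ S Nc (allEventsₛ σ Nc) {f} t j = false := by
  rw [detZₛ_singleton hσ Nc f h₁ h₂, ancZxₛ_of_not_initZ σ S f hf, decide_eq_false ht.1, decide_eq_false ht.2]
  simp

/-- δ = 1 LOCALITY (`X`-detectors). -/
theorem detXₛ_local {σ : SMSchedule} {S : SMCode ℓ m} (hσ : σ.CycleFacts S) (Nc : ℕ) (f : Fault ℓ m) (h₁ : 1 ≤ f.cyc) (h₂ : f.cyc ≤ Nc)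
    {t : ℕ} (ht : t ≠ f.cyc ∧ t ≠ f.cyc + 1) (i : BB.Mono ℓ m) : Gen.detX S Nc (allEventsₛ σ Nc) {f} t i = false := by
  rw [detXₛ_singleton hσ Nc f h₁ h₂, decide_eq_false ht.1, decide_eq_false ht.2]
  simp

/-- Set level: the columns of a normal set are the same in every long-enough circuit. -/
theorem sameColsₛ_indep {σ : SMSchedule} {S : SMCode ℓ m} (hσ : σ.CycleFacts S) {Nc Nc' : ℕ} (F : Finset (Fault ℓ m)) (hN : Normal Nc F)
    (hN' : ∀ f ∈ F, f.cyc ≤ Nc') :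
    (∀ t i, Gen.detX S Nc' (allEventsₛ σ Nc') F t i = Gen.detX S Nc (allEventsₛ σ Nc) F t i) ∧
    (∀ t j, Gen.detZ S Nc' (allEventsₛ σ Nc') F t j = Gen.detZ S Nc (allEventsₛ σ Nc) F t j) ∧
      Gen.dataX S (allEventsₛ σ Nc') F = Gen.dataX S (allEventsₛ σ Nc) F ∧
      Gen.dataZ S (allEventsₛ σ Nc') F = Gen.dataZ S (allEventsₛ σ Nc) F := by
  refine ⟨fun t i => ?_, fun t j => ?_, ?_, ?_⟩
  · rw [Gen.detX_eq_bsum, Gen.detX_eq_bsum S Nc]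
    exact bsum_congr fun f hf => detXₛ_indep hσ f (hN f hf).1 (hN' f hf) (hN f hf).2.1 t i
  · rw [Gen.detZ_eq_bsum, Gen.detZ_eq_bsum S Nc]
    exact bsum_congr fun f hf => detZₛ_indep hσ f (hN f hf).2.2 (hN f hf).1 (hN' f hf) (hN f hf).2.1 t j
  · rw [Gen.dataX_eq_sum, Gen.dataX_eq_sum S (allEventsₛ σ Nc)]
    exact Finset.sum_congr rfl fun f hf => by
      rw [dataXₛ_singleton hσ Nc' f (hN f hf).1 (hN' f hf), dataXₛ_singleton hσ Nc f (hN f hf).1 (hN f hf).2.1]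
  · rw [Gen.dataZ_eq_sum, Gen.dataZ_eq_sum S (allEventsₛ σ Nc)]
    exact Finset.sum_congr rfl fun f hf => by
      rw [dataZₛ_singleton hσ Nc' f (hN f hf).1 (hN' f hf), dataZₛ_singleton hσ Nc f (hN f hf).1 (hN f hf).2.1]

/-- A normal undetectable logical set of the `Nc`-circuit is one of any circuit containing its cycles. -/
theorem transfer_normalₛ {σ : SMSchedule} {S : SMCode ℓ m} (hσ : σ.CycleFacts S) {Nc Nc' : ℕ} (F : Finset (Fault ℓ m)) (hN : Normal Nc F)
    (hN' : ∀ f ∈ F, f.cyc ≤ Nc') (hU : Undetectableₛ σ S Nc F) (hL : LogicalErrorₛ σ S Nc F) :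
    Undetectableₛ σ S Nc' F ∧ LogicalErrorₛ σ S Nc' F := by
  obtain ⟨hX, hZ, hdX, hdZ⟩ := sameColsₛ_indep hσ F hN hN'
  refine ⟨⟨fun f hf => ?_, fun t i => ⟨?_, ?_⟩⟩, ?_⟩
  · rw [hσ.mem_allEventsₛ_iff, Fault.ev_cyc]; exact ⟨(hN f hf).1, hN' f hf⟩
  · rw [hX]; exact (hU.2 t i).1
  · rw [hZ]; exact (hU.2 t i).2
  · unfold LogicalErrorₛ Gen.LogicalError at hL ⊢; rw [hdX, hdZ]; exact hL



/-! ## The one-cycle shapes of `InitZ` faults and `MeasZ` flips -/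

/-- The shape of a fault in terms of the events after it. -/
theorem shapeₛ_eq_evolve_delta (σ : SMSchedule) (S : SMCode ℓ m) (f : Fault ℓ m) (pre post : List Ev)
    (h : cycleEventsₛ σ f.cyc = pre ++ f.ev :: post) (hpre : f.ev ∉ pre) (hpost : f.ev ∉ post) :
    shapeₛ σ S f = evolve S post (delta S f) := by
  unfold shapeₛ
  rw [h, simulate_append, simulate_of_not_mem S f hpre, evolve_init, simulate_cons, if_pos rfl, applyEv_init,
    simulate_of_not_mem S f hpost]
  rfl


/-- The `delta` of a `MeasZ` flip. -/
theorem delta_measZ (S : SMCode ℓ m) (c : ℕ) (j : BB.Mono ℓ m) :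
    delta S (Fault.measZ c j) = ⟨State.init.frame, fun _ _ => false, fun c' i' => if c' = c ∧ i' = j then true else false⟩ := by
  refine State.ext' rfl rfl ?_
  funext c' i'; simp [delta, inject, State.init]

omit [NeZero ℓ] [NeZero m] in
/-- Events of a round are `InitX`, `CNOT`, `MeasZ` or idles: never an `InitZ`, even re-tagged. -/
theorem SMSchedule.retag_ne_initZ_of_mem_roundEvents (σ : SMSchedule) {r : ℕ} {e : Ev} (h : e ∈ σ.roundEvents r) (c c' : ℕ) :
    Ev.retag c e ≠ Ev.initZ c' := by
  unfold SMSchedule.roundEvents at h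
  simp only [List.mem_append, List.mem_map] at h
  rcases h with ((((h | ⟨l, -, rfl⟩) | ⟨l, -, rfl⟩) | h) | h) | h
  · split_ifs at h <;> simp_all [Ev.retag]
  · simp [Ev.retag]
  · simp [Ev.retag]
  · split_ifs at h <;> simp_all [Ev.retag]
  · split_ifs at h <;> simp_all [Ev.retag]
  · split_ifs at h <;> simp_all [Ev.retag]

omit [NeZero ℓ] [NeZero m] in
/-- … never a `MeasX`. -/
theorem SMSchedule.retag_ne_measX_of_mem_roundEvents (σ : SMSchedule) {r : ℕ} {e : Ev} (h : e ∈ σ.roundEvents r) (c c' : ℕ) :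
    Ev.retag c e ≠ Ev.measX c' := by
  unfold SMSchedule.roundEvents at h
  simp only [List.mem_append, List.mem_map] at h
  rcases h with ((((h | ⟨l, -, rfl⟩) | ⟨l, -, rfl⟩) | h) | h) | h
  · split_ifs at h <;> simp_all [Ev.retag]
  · simp [Ev.retag]
  · simp [Ev.retag]
  · split_ifs at h <;> simp_all [Ev.retag]
  · split_ifs at h <;> simp_all [Ev.retag]
  · split_ifs at h <;> simp_all [Ev.retag]

omit [NeZero ℓ] [NeZero m] in
/-- … and a `MeasZ` only in round 7. -/
theorem SMSchedule.eq_seven_of_retag_eq_measZ (σ : SMSchedule) {r : ℕ} {e : Ev} (h : e ∈ σ.roundEvents r) (c c' : ℕ)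
    (he : Ev.retag c e = Ev.measZ c') : r = 7 := by
  unfold SMSchedule.roundEvents at h
  simp only [List.mem_append, List.mem_map] at h
  rcases h with ((((h | ⟨l, -, rfl⟩) | ⟨l, -, rfl⟩) | h) | h) | h
  · split_ifs at h <;> simp_all [Ev.retag]
  · simp [Ev.retag] at he
  · simp [Ev.retag] at he
  · split_ifs at h with h7 <;> simp_all [Ev.retag]
  · split_ifs at h <;> simp_all [Ev.retag]
  · split_ifs at h <;> simp_all [Ev.retag]

omit [NeZero ℓ] [NeZero m] in
/-- The `InitZ` of cycle `c` does not occur among the re-tagged round events and the `MeasX`. -/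
theorem SMSchedule.initZ_notMem_pre (σ : SMSchedule) (c : ℕ) :
    Ev.initZ c ∉ (σ.roundEvents 1 ++ σ.roundEvents 2 ++ σ.roundEvents 3 ++ σ.roundEvents 4 ++ σ.roundEvents 5 ++
      σ.roundEvents 6 ++ σ.roundEvents 7).map (Ev.retag c) ++ [.measX c] := by
  simp only [List.mem_append, List.mem_map, List.mem_singleton, not_or]
  refine ⟨?_, by simp⟩
  rintro ⟨e, he, hec⟩
  rcases he with (((((h | h) | h) | h) | h) | h) | h <;> exact σ.retag_ne_initZ_of_mem_roundEvents h c c hec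

/-- The shape of an `InitZ` fault, for every order. -/
theorem shapeₛ_initZ (σ : SMSchedule) (S : SMCode ℓ m) (c : ℕ) (j : BB.Mono ℓ m) :
    shapeₛ σ S (Fault.initZ c j) = ⟨State.init.frame.mulAt (Reg.Z, j) (true, false), fun _ _ => false, fun _ _ => false⟩ := by
  rw [shapeₛ_eq_evolve_delta σ S (Fault.initZ c j)
    ((σ.roundEvents 1 ++ σ.roundEvents 2 ++ σ.roundEvents 3 ++ σ.roundEvents 4 ++ σ.roundEvents 5 ++ σ.roundEvents 6 ++
      σ.roundEvents 7).map (Ev.retag c) ++ [.measX c])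
    [.idle c .L8, .idle c .R8] (by rw [cycleEventsₛ_eq_append]; rfl) (σ.initZ_notMem_pre c) (by simp [Fault.ev])]
  rfl

omit [NeZero ℓ] [NeZero m] in
/-- Round 7 splits at its `MeasZ`. -/
theorem SMSchedule.roundEvents_seven (σ : SMSchedule) :
    σ.roundEvents 7 = ((σ.layersAt 7 fun l => l.ctrl == Reg.X).map fun l => Ev.cnot 0 l) ++
      ((σ.layersAt 7 fun l => l.tgt == Reg.Z).map fun l => Ev.cnot 0 l) ++ Ev.measZ 0 ::
      ((if (σ.layersAt 7 fun l => l.dataReg == Reg.L).isEmpty then [Ev.idle 0 .L1] else []) ++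
        (if (σ.layersAt 7 fun l => l.dataReg == Reg.R).isEmpty then [Ev.idle 0 .R7] else [])) := by
  unfold SMSchedule.roundEvents
  simp [List.append_assoc]

omit [NeZero ℓ] [NeZero m] in
/-- The cycle splits at its `MeasZ`. -/
theorem cycleEventsₛ_split_measZ (σ : SMSchedule) (c : ℕ) :
    cycleEventsₛ σ c =
      ((σ.roundEvents 1 ++ σ.roundEvents 2 ++ σ.roundEvents 3 ++ σ.roundEvents 4 ++ σ.roundEvents 5 ++ σ.roundEvents 6).map (Ev.retag c) ++
        (((σ.layersAt 7 fun l => l.ctrl == Reg.X).map fun l => Ev.cnot 0 l) ++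
          ((σ.layersAt 7 fun l => l.tgt == Reg.Z).map fun l => Ev.cnot 0 l)).map (Ev.retag c)) ++
      Ev.measZ c ::
      (((if (σ.layersAt 7 fun l => l.dataReg == Reg.L).isEmpty then [Ev.idle 0 .L1] else []) ++
          (if (σ.layersAt 7 fun l => l.dataReg == Reg.R).isEmpty then [Ev.idle 0 .R7] else [])).map (Ev.retag c) ++
        [.measX c, .initZ c, .idle c .L8, .idle c .R8]) := by
  rw [cycleEventsₛ_eq_append, σ.roundEvents_seven]
  simp [List.map_append, List.append_assoc, Ev.retag]

omit [NeZero ℓ] [NeZero m] in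
/-- The `MeasZ` of cycle `c` does not occur before its position … -/
theorem SMSchedule.measZ_notMem_pre (σ : SMSchedule) (c : ℕ) :
    Ev.measZ c ∉ ((σ.roundEvents 1 ++ σ.roundEvents 2 ++ σ.roundEvents 3 ++ σ.roundEvents 4 ++ σ.roundEvents 5 ++ σ.roundEvents 6).map
        (Ev.retag c) ++
      (((σ.layersAt 7 fun l => l.ctrl == Reg.X).map fun l => Ev.cnot 0 l) ++
        ((σ.layersAt 7 fun l => l.tgt == Reg.Z).map fun l => Ev.cnot 0 l)).map (Ev.retag c)) := by
  simp only [List.mem_append, List.mem_map, not_or]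
  refine ⟨?_, ?_⟩
  · rintro ⟨e, he, hec⟩
    rcases he with ((((h | h) | h) | h) | h) | h <;> have := σ.eq_seven_of_retag_eq_measZ h c c hec <;> omega
  · rintro ⟨e, he, hec⟩
    rcases he with ⟨l, -, rfl⟩ | ⟨l, -, rfl⟩ <;> simp [Ev.retag] at hec

omit [NeZero ℓ] [NeZero m] in
/-- … nor after it. -/
theorem SMSchedule.measZ_notMem_post (σ : SMSchedule) (c : ℕ) :
    Ev.measZ c ∉ ((if (σ.layersAt 7 fun l => l.dataReg == Reg.L).isEmpty then [Ev.idle 0 .L1] else []) ++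
        (if (σ.layersAt 7 fun l => l.dataReg == Reg.R).isEmpty then [Ev.idle 0 .R7] else [])).map (Ev.retag c) ++
      [.measX c, .initZ c, .idle c .L8, .idle c .R8] := by
  simp only [List.mem_append, List.mem_map, not_or]
  refine ⟨?_, by simp⟩
  rintro ⟨e, he, hec⟩
  rcases he with h | h <;> split_ifs at h <;> simp_all [Ev.retag]

/-- The shape of a `MeasZ` flip, for every order. -/
theorem shapeₛ_measZ (σ : SMSchedule) (S : SMCode ℓ m) (c : ℕ) (j : BB.Mono ℓ m) :
    shapeₛ σ S (Fault.measZ c j) = ⟨State.init.frame, fun _ _ => false, fun c' i' => if c' = c ∧ i' = j then true else false⟩ := by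
  rw [shapeₛ_eq_evolve_delta σ S (Fault.measZ c j) _ _ (by rw [cycleEventsₛ_split_measZ]; rfl) (σ.measZ_notMem_pre c)
    (σ.measZ_notMem_post c), delta_measZ, evolve_frame_init]

/-! ## Shape data and columns of `InitZ` faults and `MeasZ` flips -/

/-- Shape data of an `InitZ` fault: no `Z`-flips. -/
theorem mZ_initZₛ (σ : SMSchedule) (S : SMCode ℓ m) (c t : ℕ) (j j' : BB.Mono ℓ m) : (shapeₛ σ S (Fault.initZ c j)).mZ t j' = false := by
  rw [shapeₛ_initZ]

/-- Shape data of an `InitZ` fault: no `X`-flips. -/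
theorem mX_initZₛ (σ : SMSchedule) (S : SMCode ℓ m) (c t : ℕ) (j i : BB.Mono ℓ m) : (shapeₛ σ S (Fault.initZ c j)).mX t i = false := by
  rw [shapeₛ_initZ]

/-- Shape data of an `InitZ` fault: no data `X`-error. -/
theorem dataXb_initZₛ (σ : SMSchedule) (S : SMCode ℓ m) (c : ℕ) (j : BB.Mono ℓ m) : (shapeₛ σ S (Fault.initZ c j)).frame.dataXb = fun _ => false := by
  rw [shapeₛ_initZ]; funext q; rcases q with i | i <;> simp [Frame.dataXb, Frame.mulAt, State.init]

/-- Shape data of an `InitZ` fault: no data `Z`-error. -/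
theorem dataZb_initZₛ (σ : SMSchedule) (S : SMCode ℓ m) (c : ℕ) (j : BB.Mono ℓ m) : (shapeₛ σ S (Fault.initZ c j)).frame.dataZb = fun _ => false := by
  rw [shapeₛ_initZ]; funext q; rcases q with i | i <;> simp [Frame.dataZb, Frame.mulAt, State.init]

/-- Shape data of an `InitZ` fault: `ζ = e_j`. -/
theorem ancZxₛ_initZ (σ : SMSchedule) (S : SMCode ℓ m) (c : ℕ) (j j' : BB.Mono ℓ m) :
    (shapeₛ σ S (Fault.initZ c j)).frame.ancZx j' = decide (j' = j) := by
  rw [shapeₛ_ancZx]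
  by_cases h : j' = j
  · subst h; simp [Fault.cyc]
  · simp [Fault.cyc, Ne.symm h, h]

/-- Shape data of a `MeasZ` flip: the one `Z`-flip. -/
theorem mZ_measZₛ (σ : SMSchedule) (S : SMCode ℓ m) (c t : ℕ) (j j' : BB.Mono ℓ m) :
    (shapeₛ σ S (Fault.measZ c j)).mZ t j' = decide (t = c ∧ j' = j) := by
  rw [shapeₛ_measZ]; dsimp only; split_ifs with h <;> simp [h]

/-- Shape data of a `MeasZ` flip: no `X`-flips. -/
theorem mX_measZₛ (σ : SMSchedule) (S : SMCode ℓ m) (c t : ℕ) (j i : BB.Mono ℓ m) : (shapeₛ σ S (Fault.measZ c j)).mX t i = false := by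
  rw [shapeₛ_measZ]

/-- Shape data of a `MeasZ` flip: no data `X`-error. -/
theorem dataXb_measZₛ (σ : SMSchedule) (S : SMCode ℓ m) (c : ℕ) (j : BB.Mono ℓ m) : (shapeₛ σ S (Fault.measZ c j)).frame.dataXb = fun _ => false := by
  rw [shapeₛ_measZ]; funext q; rcases q with i | i <;> rfl

/-- Shape data of a `MeasZ` flip: no data `Z`-error. -/
theorem dataZb_measZₛ (σ : SMSchedule) (S : SMCode ℓ m) (c : ℕ) (j : BB.Mono ℓ m) : (shapeₛ σ S (Fault.measZ c j)).frame.dataZb = fun _ => false := by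
  rw [shapeₛ_measZ]; funext q; rcases q with i | i <;> rfl

/-- Column of an `InitZ` fault: `Z`-detectors `(c+1, j)` and `(c+2, j)` if cycle `c+1` exists, else nothing. -/
theorem detZₛ_initZ {σ : SMSchedule} {S : SMCode ℓ m} (hσ : σ.CycleFacts S) (Nc c : ℕ) (j : BB.Mono ℓ m) (h₁ : 1 ≤ c) (h₂ : c ≤ Nc) (t : ℕ) (j' : BB.Mono ℓ m) :
    Gen.detZ S Nc (allEventsₛ σ Nc) {Fault.initZ c j} t j' = (decide (c + 1 ≤ Nc) && decide (j' = j) && (decide (t = c + 1) || decide (t = c + 2))) := by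
  have hc : (Fault.initZ c j : Fault ℓ m).cyc = c := rfl
  rw [detZₛ_singleton hσ Nc (Fault.initZ c j) h₁ h₂, hc]
  simp only [mZ_initZₛ, dataXb_initZₛ, synZ_zero, ancZxₛ_initZ]
  generalize decide (c + 1 ≤ Nc) = b4
  generalize decide (j' = j) = b5
  by_cases h1 : t = c + 1
  · rw [decide_eq_true h1, decide_eq_false (show ¬ t = c + 2 by omega), decide_eq_false (show ¬ t = c by omega)]
    cases b4 <;> cases b5 <;> rfl
  · rw [decide_eq_false h1]
    by_cases h2 : t = c + 2
    · rw [decide_eq_true h2, decide_eq_false (show ¬ t = c by omega)]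
      cases b4 <;> cases b5 <;> rfl
    · rw [decide_eq_false h2]
      generalize decide (t = c) = b1
      cases b1 <;> cases b4 <;> cases b5 <;> rfl

/-- Column of an `InitZ` fault: no `X`-detectors. -/
theorem detXₛ_initZ {σ : SMSchedule} {S : SMCode ℓ m} (hσ : σ.CycleFacts S) (Nc c : ℕ) (j : BB.Mono ℓ m) (h₁ : 1 ≤ c) (h₂ : c ≤ Nc) (t : ℕ) (i : BB.Mono ℓ m) :
    Gen.detX S Nc (allEventsₛ σ Nc) {Fault.initZ c j} t i = false := by
  have hc : (Fault.initZ c j : Fault ℓ m).cyc = c := rfl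
  rw [detXₛ_singleton hσ Nc (Fault.initZ c j) h₁ h₂, hc]
  simp only [mX_initZₛ, dataZb_initZₛ, synX_zero]
  generalize decide (t = c) = b1
  generalize decide (t = c + 1) = b2
  cases b1 <;> cases b2 <;> rfl

/-- Column of a `MeasZ` flip: `Z`-detectors `(c, j)` and `(c+1, j)`. -/
theorem detZₛ_measZ {σ : SMSchedule} {S : SMCode ℓ m} (hσ : σ.CycleFacts S) (Nc c : ℕ) (j : BB.Mono ℓ m) (h₁ : 1 ≤ c) (h₂ : c ≤ Nc) (t : ℕ) (j' : BB.Mono ℓ m) :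
    Gen.detZ S Nc (allEventsₛ σ Nc) {Fault.measZ c j} t j' = (decide (j' = j) && (decide (t = c) || decide (t = c + 1))) := by
  have hc : (Fault.measZ c j : Fault ℓ m).cyc = c := rfl
  rw [detZₛ_singleton hσ Nc (Fault.measZ c j) h₁ h₂, hc]
  simp only [mZ_measZₛ, dataXb_measZₛ, synZ_zero, ancZxₛ_of_not_initZ σ S (Fault.measZ c j) rfl, true_and]
  generalize decide (c + 1 ≤ Nc) = b4
  generalize decide (j' = j) = b5
  by_cases h1 : t = c
  · rw [decide_eq_true h1, decide_eq_false (show ¬ t = c + 1 by omega), decide_eq_false (show ¬ t = c + 2 by omega)]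
    cases b4 <;> cases b5 <;> rfl
  · rw [decide_eq_false h1]
    by_cases h2 : t = c + 1
    · rw [decide_eq_true h2, decide_eq_false (show ¬ t = c + 2 by omega)]
      cases b4 <;> cases b5 <;> rfl
    · rw [decide_eq_false h2]
      generalize decide (t = c + 2) = b3
      cases b3 <;> cases b4 <;> cases b5 <;> rfl

/-- Column of a `MeasZ` flip: no `X`-detectors. -/
theorem detXₛ_measZ {σ : SMSchedule} {S : SMCode ℓ m} (hσ : σ.CycleFacts S) (Nc c : ℕ) (j : BB.Mono ℓ m) (h₁ : 1 ≤ c) (h₂ : c ≤ Nc) (t : ℕ) (i : BB.Mono ℓ m) :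
    Gen.detX S Nc (allEventsₛ σ Nc) {Fault.measZ c j} t i = false := by
  have hc : (Fault.measZ c j : Fault ℓ m).cyc = c := rfl
  rw [detXₛ_singleton hσ Nc (Fault.measZ c j) h₁ h₂, hc]
  simp only [mX_measZₛ, dataZb_measZₛ, synX_zero]
  generalize decide (t = c) = b1
  generalize decide (t = c + 1) = b2
  cases b1 <;> cases b2 <;> rfl

/-- An `InitZ` fault of cycle `c` and the `MeasZ`-flip of cycle `c+1` on the same ancilla have IDENTICAL columns in every
circuit containing cycle `c+1`. -/
theorem initZ_measZ_sameColsₛ {σ : SMSchedule} {S : SMCode ℓ m} (hσ : σ.CycleFacts S) (Nc c : ℕ)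
    (j : BB.Mono ℓ m) (h₁ : 1 ≤ c) (h₂ : c + 1 ≤ Nc) :
    Gen.SameCols S Nc (allEventsₛ σ Nc) {Fault.initZ c j} {Fault.measZ (c + 1) j} := by
  refine ⟨fun t i => ?_, fun t j' => ?_, ?_, ?_⟩
  · rw [detXₛ_initZ hσ Nc c j h₁ (by omega), detXₛ_measZ hσ Nc (c + 1) j (by omega) h₂]
  · rw [detZₛ_initZ hσ Nc c j h₁ (by omega), detZₛ_measZ hσ Nc (c + 1) j (by omega) h₂, decide_eq_true h₂, Bool.true_and]
  · rw [dataXₛ_singleton hσ Nc (Fault.measZ (c + 1) j) (show 1 ≤ c + 1 by omega) h₂,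
      dataXₛ_singleton hσ Nc (Fault.initZ c j) h₁ (show c ≤ Nc by omega), dataXb_initZₛ, dataXb_measZₛ]
  · rw [dataZₛ_singleton hσ Nc (Fault.measZ (c + 1) j) (show 1 ≤ c + 1 by omega) h₂,
      dataZₛ_singleton hσ Nc (Fault.initZ c j) h₁ (show c ≤ Nc by omega), dataZb_initZₛ, dataZb_measZₛ]

/-- An `InitZ` fault of the LAST cycle has the zero column. -/
theorem initZ_last_sameColsₛ {σ : SMSchedule} {S : SMCode ℓ m} (hσ : σ.CycleFacts S) (Nc : ℕ) (j : BB.Mono ℓ m)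
    (h : 1 ≤ Nc) : Gen.SameCols S Nc (allEventsₛ σ Nc) {Fault.initZ Nc j} ∅ := by
  have h0X : ∀ t i, Gen.detX S Nc (allEventsₛ σ Nc) (∅ : Finset (Fault ℓ m)) t i = false := fun t i => by
    rw [Gen.detX_eq_bsum]; exact bsum_empty _
  have h0Z : ∀ t j, Gen.detZ S Nc (allEventsₛ σ Nc) (∅ : Finset (Fault ℓ m)) t j = false := fun t j => by
    rw [Gen.detZ_eq_bsum]; exact bsum_empty _
  refine ⟨fun t i => ?_, fun t j' => ?_, ?_, ?_⟩
  · rw [h0X, detXₛ_initZ hσ Nc Nc j h le_rfl]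
  · rw [h0Z, detZₛ_initZ hσ Nc Nc j h le_rfl, decide_eq_false (show ¬ Nc + 1 ≤ Nc by omega), Bool.false_and, Bool.false_and]
  · rw [dataXₛ_singleton hσ Nc (Fault.initZ Nc j) h (le_refl Nc), dataXb_initZₛ, Gen.dataX_eq_sum, Finset.sum_empty]; rfl
  · rw [dataZₛ_singleton hσ Nc (Fault.initZ Nc j) h (le_refl Nc), dataZb_initZₛ, Gen.dataZ_eq_sum, Finset.sum_empty]; rfl

end Summit.Ventures.QEC.CircuitDistance
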